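import Mathlib
import Summits.Ventures.PercRepro2.Defs
import Summits.Ventures.PercRepro2.Harris
import Summits.Ventures.PercRepro2.Graph
import Summits.Ventures.PercRepro2.Events
import Summits.Ventures.PercRepro2.R21PairFrame

/-!
# (R2-1) from the nonnegativity of its tensor-Bernstein coefficients (PercRepro2, p2)

The (R2-1) slack `R(p) = B(p, p)` is the diagonal of the bilinear form

  `B(p, q) = P_p(𝟙ah) + P_p(𝟙ℓa) + P_p(𝟙)·P_q(ah) − P_p(𝟙a)·P_q(h) − P_p(𝟙h)·P_q(a) − P_p(𝟙ℓ)·P_q(a)`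

(`𝟙 = {s ↮ y}`, `a = {u ∈ C_s}`, `h = {o ∈ C_s}`, `ℓ = {o ↔ y}`; `r21Bil`).  Along one edge `g`
every mass is affine in the weight (`prob_eq_pin`), so `B` has the bilinear Bernstein expansion
`r21Bil_bernstein`.  The **multi-mixed coefficient** of a set `F` of edges is the ANTIPODAL sum

  `M_F(p) = ∑_{η : E → Bool} B(p[F ↦ η], p[F ↦ η̄])`,   `η̄ = !η`   (`r21Anti`),

the sum over all ways of pinning `F` in the two arguments to COMPLEMENTARY point configurations
(the edges outside `F` keep the weights `p`; the sum runs over all `η : E → Bool`, so every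
distinct pair is counted `2^{|E ∖ F|}` times — a harmless positive factor).  `M_∅(p)` is
`2^{|E|}·R(p)`, and for an edge `g ∉ F` (`r21Anti_bernstein`)

  `M_F(p) = (1 − p_g)²·M_F(p[g↦0]) + 2·p_g(1 − p_g)·M_{F ∪ {g}}(p) + p_g²·M_F(p[g↦1])`.

Hence, by the pin induction (`pin_induction`), **if every antipodal sum at every point mass is
nonnegative — the statement (BERN-ALL): for every `p ∈ {0,1}^E` and every `F`, `0 ≤ M_F(p)` —
then (R2-1) holds for every weight vector** (`r21_of_bernall`).  (BERN-ALL) says exactly that every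
coefficient of `R` in the tensor Bernstein basis `∏_e B_{k_e}(p_e)` is nonnegative; in the
2-colouring language (`η` = the open edges, `η̄` = the closed ones) it is the integer inequality

  `∑_η [s ≁₁ y]·([u ∈ C¹_s] − [u ∈ C⁰_s])·([o ∈ C¹_s ∪ C¹_y] − [o ∈ C⁰_s]) ≥ 0`

for every multigraph (P2-G20 record; exhaustive on 5 vertices, 0 / 512,000).

* `pinOn` — pin the weights on `F` to a point configuration; its update / insert lemmas;
* `r21Bil`, `r21Bil_bernstein` — the bilinear form and its one-edge expansion;
* `r21Anti`, `r21Anti_update_of_mem`, `r21Anti_mixed`, `r21Anti_bernstein` — the antipodal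
  coefficients and their one-edge expansion;
* `r21_of_bernall` — **(BERN-ALL) ⟹ (R2-1)**.
-/

namespace Summit.Ventures.PercRepro2

section BernAll

variable {V : Type*} {E : Type*} [Fintype E] [DecidableEq E]
  {R : Type*} [CommRing R] [LinearOrder R] [IsStrictOrderedRing R]

/-- Pin the weights on `F` to the point configuration `η` (`1` on the edges with `η e = true`,
`0` on the others), keep `p` elsewhere. -/
def pinOn (p : E → R) (F : Finset E) (η : E → Bool) : E → R :=
  fun e => if e ∈ F then (if η e then 1 else 0) else p e

omit [Fintype E] [LinearOrder R] [IsStrictOrderedRing R] in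
/-- Outside `F` the pinned vector agrees with `p`. -/
lemma pinOn_apply_of_notMem (p : E → R) (F : Finset E) (η : E → Bool) {e : E} (he : e ∉ F) :
    pinOn p F η e = p e := by
  simp [pinOn, he]

omit [Fintype E] [LinearOrder R] [IsStrictOrderedRing R] in
/-- Updating an edge outside `F` commutes with pinning on `F`. -/
lemma pinOn_update_of_notMem (p : E → R) (F : Finset E) (η : E → Bool) {g : E} (hg : g ∉ F)
    (c : R) : pinOn (Function.update p g c) F η = Function.update (pinOn p F η) g c := by
  funext e
  by_cases he : e = g
  · subst he
    simp [pinOn, hg]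
  · simp [pinOn, Function.update_of_ne he]

omit [Fintype E] [LinearOrder R] [IsStrictOrderedRing R] in
/-- Updating an edge inside `F` is invisible after pinning on `F`. -/
lemma pinOn_update_of_mem (p : E → R) (F : Finset E) (η : E → Bool) {g : E} (hg : g ∈ F)
    (c : R) : pinOn (Function.update p g c) F η = pinOn p F η := by
  funext e
  by_cases he : e = g
  · subst he
    simp [pinOn, hg]
  · simp [pinOn, Function.update_of_ne he]

omit [Fintype E] [LinearOrder R] [IsStrictOrderedRing R] in
/-- Pinning on `insert g F` is pinning on `F` followed by pinning `g`. -/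
lemma pinOn_insert (p : E → R) (F : Finset E) (η : E → Bool) (g : E) :
    pinOn p (insert g F) η = Function.update (pinOn p F η) g (if η g then 1 else 0) := by
  funext e
  by_cases he : e = g
  · subst he
    simp [pinOn]
  · simp [pinOn, he]

omit [Fintype E] [LinearOrder R] [IsStrictOrderedRing R] in
/-- The value of `η` at an edge outside `F` is irrelevant to `pinOn p F η`. -/
lemma pinOn_update_eta_of_notMem (p : E → R) (F : Finset E) (η : E → Bool) {g : E} (hg : g ∉ F)
    (b : Bool) : pinOn p F (Function.update η g b) = pinOn p F η := by
  funext e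
  by_cases he : e = g
  · subst he
    simp [pinOn, hg]
  · simp [pinOn, Function.update_of_ne he]

omit [Fintype E] [LinearOrder R] [IsStrictOrderedRing R] in
/-- The complement of an updated configuration. -/
lemma not_update_eq (η : E → Bool) (g : E) (b : Bool) :
    (fun e => !(Function.update η g b e)) = Function.update (fun e => !η e) g (!b) := by
  funext e
  by_cases he : e = g
  · subst he
    simp
  · simp [Function.update_of_ne he]

/-- **The (R2-1) bilinear form** `B(p, q)`: its diagonal `B(p, p)` is the (R2-1) slack. -/
noncomputable def r21Bil (ends : E → Sym2 V) (s y o u : V) (p q : E → R) : R :=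
  prob p (connEvent ends s u ∩ clusterInEvent ends s {W : Set V | o ∈ W} ∩ (connEvent ends s y)ᶜ) +
    prob p (connEvent ends s u ∩ connEvent ends y o ∩ (connEvent ends s y)ᶜ) +
    prob p (connEvent ends s y)ᶜ *
      prob q (connEvent ends s u ∩ clusterInEvent ends s {W : Set V | o ∈ W}) -
    (prob p (connEvent ends s u ∩ (connEvent ends s y)ᶜ) *
        prob q (clusterInEvent ends s {W : Set V | o ∈ W}) +
      prob p (clusterInEvent ends s {W : Set V | o ∈ W} ∩ (connEvent ends s y)ᶜ) *
        prob q (connEvent ends s u) +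
      prob p (connEvent ends y o ∩ (connEvent ends s y)ᶜ) * prob q (connEvent ends s u))

omit [LinearOrder R] [IsStrictOrderedRing R] in
/-- **The bilinear Bernstein expansion along one edge** `g`. -/
lemma r21Bil_bernstein (ends : E → Sym2 V) (s y o u : V) (p q : E → R) (g : E) :
    r21Bil ends s y o u p q =
      (1 - p g) * (1 - q g) *
          r21Bil ends s y o u (Function.update p g 0) (Function.update q g 0) +
        (1 - p g) * q g * r21Bil ends s y o u (Function.update p g 0) (Function.update q g 1) +
        p g * (1 - q g) * r21Bil ends s y o u (Function.update p g 1) (Function.update q g 0) +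
        p g * q g * r21Bil ends s y o u (Function.update p g 1) (Function.update q g 1) := by
  unfold r21Bil
  rw [prob_eq_pin p (connEvent ends s u ∩ clusterInEvent ends s {W : Set V | o ∈ W} ∩
      (connEvent ends s y)ᶜ) g,
    prob_eq_pin p (connEvent ends s u ∩ connEvent ends y o ∩ (connEvent ends s y)ᶜ) g,
    prob_eq_pin p (connEvent ends s y)ᶜ g,
    prob_eq_pin p (connEvent ends s u ∩ (connEvent ends s y)ᶜ) g,
    prob_eq_pin p (clusterInEvent ends s {W : Set V | o ∈ W} ∩ (connEvent ends s y)ᶜ) g,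
    prob_eq_pin p (connEvent ends y o ∩ (connEvent ends s y)ᶜ) g,
    prob_eq_pin q (connEvent ends s u ∩ clusterInEvent ends s {W : Set V | o ∈ W}) g,
    prob_eq_pin q (clusterInEvent ends s {W : Set V | o ∈ W}) g,
    prob_eq_pin q (connEvent ends s u) g]
  ring

/-- **The antipodal (multi-mixed) coefficient** of the edge set `F`:
`M_F(p) = ∑_{η : E → Bool} B(p[F ↦ η], p[F ↦ !η])`. -/
noncomputable def r21Anti (ends : E → Sym2 V) (s y o u : V) (p : E → R) (F : Finset E) : R :=
  ∑ η : E → Bool, r21Bil ends s y o u (pinOn p F η) (pinOn p F (fun e => !η e))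

omit [LinearOrder R] [IsStrictOrderedRing R] in
/-- `M_F` does not see the weight of an edge of `F`. -/
lemma r21Anti_update_of_mem (ends : E → Sym2 V) (s y o u : V) (p : E → R) {F : Finset E} {g : E}
    (hg : g ∈ F) (c : R) : r21Anti ends s y o u (Function.update p g c) F = r21Anti ends s y o u p F := by
  unfold r21Anti
  simp only [pinOn_update_of_mem p F _ hg c]

omit [LinearOrder R] [IsStrictOrderedRing R] in
/-- `M_∅(p) = 2^{|E|}·R(p)`. -/
lemma r21Anti_empty (ends : E → Sym2 V) (s y o u : V) (p : E → R) :
    r21Anti ends s y o u p ∅ = (Fintype.card (E → Bool) : R) * r21Bil ends s y o u p p := by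
  unfold r21Anti
  have h : ∀ η : E → Bool, pinOn p ∅ η = p := fun η => by
    funext e
    simp [pinOn]
  simp only [h, Finset.sum_const, Finset.card_univ, nsmul_eq_mul]

omit [LinearOrder R] [IsStrictOrderedRing R] in
/-- **The mixed sum is twice the antipodal coefficient of `insert g F`**: for `g ∉ F`,
`∑_η B(p[g↦0][F↦η], p[g↦1][F↦!η]) + ∑_η B(p[g↦1][F↦η], p[g↦0][F↦!η]) = 2·M_{F ∪ {g}}(p)`. -/
lemma r21Anti_mixed (ends : E → Sym2 V) (s y o u : V) (p : E → R) {F : Finset E} {g : E}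
    (hg : g ∉ F) :
    (∑ η : E → Bool, r21Bil ends s y o u (pinOn (Function.update p g 0) F η)
        (pinOn (Function.update p g 1) F (fun e => !η e))) +
      (∑ η : E → Bool, r21Bil ends s y o u (pinOn (Function.update p g 1) F η)
        (pinOn (Function.update p g 0) F (fun e => !η e))) =
      2 * r21Anti ends s y o u p (insert g F) := by
  classical
  -- the involution flipping the value at `g`
  let σ : (E → Bool) ≃ (E → Bool) :=
    { toFun := fun η => Function.update η g (!η g)
      invFun := fun η => Function.update η g (!η g)
      left_inv := fun η => by
        simp only [Function.update_self, Bool.not_not, Function.update_idem, Function.update_eq_self]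
      right_inv := fun η => by
        simp only [Function.update_self, Bool.not_not, Function.update_idem, Function.update_eq_self] }
  set f : (E → Bool) → R := fun η => r21Bil ends s y o u (pinOn p (insert g F) η)
    (pinOn p (insert g F) (fun e => !η e)) with hf
  have hsum : r21Anti ends s y o u p (insert g F) = ∑ η, f η := rfl
  have hσ : ∑ η, f η = ∑ η, f (σ η) := (Equiv.sum_comp σ f).symm
  have hpt : ∀ η : E → Bool, f η + f (σ η) =
      r21Bil ends s y o u (pinOn (Function.update p g 0) F η)
          (pinOn (Function.update p g 1) F (fun e => !η e)) +
        r21Bil ends s y o u (pinOn (Function.update p g 1) F η)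
          (pinOn (Function.update p g 0) F (fun e => !η e)) := by
    intro η
    have hσ1 : σ η = Function.update η g (!η g) := rfl
    have e1 : pinOn p (insert g F) η =
        Function.update (pinOn p F η) g (if η g then 1 else 0) := pinOn_insert p F η g
    have e2 : pinOn p (insert g F) (fun e => !η e) =
        Function.update (pinOn p F (fun e => !η e)) g (if !η g then 1 else 0) :=
      pinOn_insert p F _ g
    have e3 : pinOn p (insert g F) (σ η) =
        Function.update (pinOn p F η) g (if !η g then 1 else 0) := by
      rw [hσ1, pinOn_insert, pinOn_update_eta_of_notMem p F η hg, Function.update_self]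
    have e4' : (fun e => !(σ η e)) = Function.update (fun e => !η e) g (η g) := by
      funext e
      by_cases he : e = g
      · subst he
        simp [hσ1]
      · simp [hσ1, Function.update_of_ne he]
    have e4 : pinOn p (insert g F) (fun e => !(σ η e)) =
        Function.update (pinOn p F (fun e => !η e)) g (if η g then 1 else 0) := by
      rw [e4', pinOn_insert, pinOn_update_eta_of_notMem p F _ hg, Function.update_self]
    simp only [hf, e1, e2, e3, e4, pinOn_update_of_notMem p F _ hg]
    cases hη : η g <;> simp [add_comm]
  calc (∑ η : E → Bool, r21Bil ends s y o u (pinOn (Function.update p g 0) F η)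
          (pinOn (Function.update p g 1) F (fun e => !η e))) +
        (∑ η : E → Bool, r21Bil ends s y o u (pinOn (Function.update p g 1) F η)
          (pinOn (Function.update p g 0) F (fun e => !η e)))
      = ∑ η : E → Bool, (f η + f (σ η)) := by
        rw [← Finset.sum_add_distrib]
        exact Finset.sum_congr rfl fun η _ => (hpt η).symm
    _ = ∑ η, f η + ∑ η, f (σ η) := Finset.sum_add_distrib
    _ = 2 * r21Anti ends s y o u p (insert g F) := by rw [← hσ, hsum]; ring

omit [LinearOrder R] [IsStrictOrderedRing R] in
/-- **The one-edge Bernstein expansion of the antipodal coefficient**: for `g ∉ F`,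
`M_F(p) = (1 − p_g)²·M_F(p[g↦0]) + 2·p_g(1 − p_g)·M_{F ∪ {g}}(p) + p_g²·M_F(p[g↦1])`. -/
lemma r21Anti_bernstein (ends : E → Sym2 V) (s y o u : V) (p : E → R) {F : Finset E} {g : E}
    (hg : g ∉ F) :
    r21Anti ends s y o u p F =
      (1 - p g) ^ 2 * r21Anti ends s y o u (Function.update p g 0) F +
        2 * (p g * (1 - p g)) * r21Anti ends s y o u p (insert g F) +
        p g ^ 2 * r21Anti ends s y o u (Function.update p g 1) F := by
  have e1 : ∀ η : E → Bool, r21Bil ends s y o u (pinOn p F η) (pinOn p F (fun e => !η e)) =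
      (1 - p g) * (1 - p g) * r21Bil ends s y o u (pinOn (Function.update p g 0) F η)
          (pinOn (Function.update p g 0) F (fun e => !η e)) +
        (1 - p g) * p g * r21Bil ends s y o u (pinOn (Function.update p g 0) F η)
          (pinOn (Function.update p g 1) F (fun e => !η e)) +
        p g * (1 - p g) * r21Bil ends s y o u (pinOn (Function.update p g 1) F η)
          (pinOn (Function.update p g 0) F (fun e => !η e)) +
        p g * p g * r21Bil ends s y o u (pinOn (Function.update p g 1) F η)
          (pinOn (Function.update p g 1) F (fun e => !η e)) := by
    intro η
    rw [r21Bil_bernstein ends s y o u _ _ g]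
    simp only [pinOn_apply_of_notMem p F _ hg, pinOn_update_of_notMem p F _ hg]
  have hmix := r21Anti_mixed ends s y o u p hg
  unfold r21Anti at hmix ⊢
  rw [Finset.sum_congr rfl fun η _ => e1 η]
  simp only [Finset.sum_add_distrib, ← Finset.mul_sum]
  linear_combination (p g * (1 - p g)) * hmix

/-- **(R2-1) from (BERN-ALL).**  If every antipodal coefficient at every point mass is
nonnegative — `0 ≤ M_F(p)` for every `p ∈ {0,1}^E` and every edge set `F` (the nonnegativity of
every tensor-Bernstein coefficient of the (R2-1) polynomial) — then (R2-1) holds for every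
admissible weight vector. -/
theorem r21_of_bernall (ends : E → Sym2 V) (s y o u : V)
    (hB : ∀ p : E → R, IsProbVec p → (∀ e, p e = 0 ∨ p e = 1) →
      ∀ F : Finset E, 0 ≤ r21Anti ends s y o u p F) :
    ∀ p : E → R, IsProbVec p →
      0 ≤ prob p (connEvent ends s u ∩ clusterInEvent ends s {W : Set V | o ∈ W} ∩
            (connEvent ends s y)ᶜ) +
          prob p (connEvent ends s u ∩ connEvent ends y o ∩ (connEvent ends s y)ᶜ) +
          prob p (connEvent ends s y)ᶜ *
            prob p (connEvent ends s u ∩ clusterInEvent ends s {W : Set V | o ∈ W}) -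
          (prob p (connEvent ends s u ∩ (connEvent ends s y)ᶜ) *
              prob p (clusterInEvent ends s {W : Set V | o ∈ W}) +
            prob p (clusterInEvent ends s {W : Set V | o ∈ W} ∩ (connEvent ends s y)ᶜ) *
              prob p (connEvent ends s u) +
            prob p (connEvent ends y o ∩ (connEvent ends s y)ᶜ) * prob p (connEvent ends s u)) := by
  have key : ∀ p : E → R, IsProbVec p → ∀ F : Finset E, 0 ≤ r21Anti ends s y o u p F := by
    refine pin_induction (fun p : E → R => ∀ F : Finset E, 0 ≤ r21Anti ends s y o u p F) hB ?_
    intro p hp hex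
    obtain ⟨g, hg0, hg1⟩ := hex
    refine ⟨g, hg0, hg1, fun h0 h1 F => ?_⟩
    by_cases hgF : g ∈ F
    · rw [← r21Anti_update_of_mem ends s y o u p hgF 0]
      exact h0 F
    · rw [r21Anti_bernstein ends s y o u p hgF]
      have h2 : 0 ≤ r21Anti ends s y o u p (insert g F) := by
        rw [← r21Anti_update_of_mem ends s y o u p (Finset.mem_insert_self g F) 0]
        exact h0 (insert g F)
      have hq0 := hp.nonneg g
      have hq1 := hp.le_one g
      have ha : 0 ≤ (1 - p g) ^ 2 * r21Anti ends s y o u (Function.update p g 0) F :=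
        mul_nonneg (sq_nonneg _) (h0 F)
      have hb : 0 ≤ 2 * (p g * (1 - p g)) * r21Anti ends s y o u p (insert g F) :=
        mul_nonneg (mul_nonneg (by norm_num) (mul_nonneg hq0 (by linarith))) h2
      have hc : 0 ≤ p g ^ 2 * r21Anti ends s y o u (Function.update p g 1) F :=
        mul_nonneg (sq_nonneg _) (h1 F)
      linarith
  intro p hp
  have h := key p hp ∅
  rw [r21Anti_empty] at h
  have hcard : (0 : R) < (Fintype.card (E → Bool) : R) := by
    exact_mod_cast Fintype.card_pos
  rcases lt_or_ge (r21Bil ends s y o u p p) 0 with hneg | hpos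
  · exfalso
    have := mul_neg_of_pos_of_neg hcard hneg
    linarith
  · exact hpos

end BernAll

end Summit.Ventures.PercRepro2
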